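import Literature.Geometry.Lorentzian.NullFocusing
import Literature.Geometry.Lorentzian.CurvatureRegularity
import Literature.Geometry.Lorentzian.TrappedSurface
import Mathlib.LinearAlgebra.Matrix.BilinearForm
import HarnessLib

/-!
# The expansion of the null normal congruence as the null expansion of its slices

Layer L4 (b) / L1 preparation of the proof programme of
`Literature.Geometry.Lorentzian.ChruscielEtAl2001_areaTheorem`. In `NullFocusing.lean` the
expansion along a generator `γ_z` of the congruence `E(y, t) = exp_{f y}(t L y)` of null normal
geodesics of `(f, L)` is the frame-free quantity `θ = D'/(2D)`, `D(t) = det (g(J_k(t), J_l(t)))`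
the Gram determinant of the screen Jacobi fields. This file identifies it with the geometry of the
**slices** `ψ_t = E(·, t) : N → M`, `y ↦ exp_{f y}(t L y)`, and their null normal field
`K_t(y) = ∂_t E(y, t)` (Hawking–Ellis 1973, §4.2: `θ = χ^a{}_a` for the deviation of the null
congruence; Chruściel–Delay–Galloway–Howard 2001, §2, (2.7) and App. A: `θ` is the trace of the
null Weingarten map, positive for expansion):

* `hasDerivAt_gram` — along any curve, `(g(J_k, J_l))' = Ω + Ωᵀ`, `Ω_{kl} = g(D_t J_k, J_l)`;
* `deriv_det_gram_div_eq_trace` — **frame-free Jacobi formula**: where `D ≠ 0`,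
  `D'/(2D) = tr(G⁻¹ Ω)`, `G` the Gram matrix (no Wronskian, no frame);
* `normalDerivAlong_slice_eq`, `mfderiv_slice_eq` — for the null normal congruence,
  `D_v K_t = D_t J_v(t)` (symmetry lemma) and `dψ_t(w) = J_w(t)`: the null second fundamental form
  `χ_{K_t}(v, w) = g(D_v K_t, dψ_t w)` of the slice `ψ_t` at `z` (the tree's
  `secondFundamentalForm` applied to `K_t`) is `Ω_t(v, w) = g(D_t J_v(t), J_w(t))`
  (`val_normalDerivAlong_slice_eq_gram'`);
* `nullExpansion_slice_eq_logDeriv_gram` — consequently, whenever the slice `ψ_t` is a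
  spacelike immersion (globally, so that the tree's `nullExpansion` is defined), its **null
  expansion at `z` with respect to `K_t` is `D'(t)/(2D(t))`** for the Gram determinant `D` of the
  Jacobi fields of any basis of `T_zN` (`trace_eq_sum_gram_inv`).

Stated for a `C^n` Lorentzian metric (`n ≥ 1`) on a Hausdorff manifold with model `𝓘(ℝ, E)` and a
manifold `N` with boundaryless model. No definitions, no named facts (D-0026).

## References

* S. W. Hawking, G. F. R. Ellis, *The large scale structure of space-time* (1973), §4.2, (4.26),
  (4.35).
* P. T. Chruściel, E. Delay, G. J. Galloway, R. Howard, Ann. Henri Poincaré 2 (2001), §2, (2.7);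
  App. A.
* B. O'Neill, *Semi-Riemannian geometry with applications to relativity* (1983), Ch. 3,
  pp. 60–61; Ch. 10, Cor. 40.
* I. Chavel, *Riemannian geometry: a modern introduction*, 2nd ed. (2006), Prop. II.8.2
  (`(det 𝒜)'/det 𝒜 = tr 𝒜'𝒜⁻¹`).
-/

noncomputable section

open Bundle Set Filter Function Matrix
open scoped Manifold ContDiff Topology Matrix

namespace Literature.Geometry.Lorentzian

open Literature.Geometry.Riemannian

universe u

/-! ### The frame-free Jacobi formula for a Gram determinant along a curve -/

section Gram

open scoped Matrix.Norms.Operator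

variable {E : Type*} [NormedAddCommGroup E] [NormedSpace ℝ E] {H : Type*} [TopologicalSpace H]
  {I : ModelWithCorners ℝ E H} {M : Type*} [TopologicalSpace M] [ChartedSpace H M]
  [IsManifold I ∞ M] [FiniteDimensional ℝ E] {n : ℕ∞ω} [Fact (1 ≤ n)]
  (g : PseudoRiemannianMetric I n E (TangentSpace I : M → Type _))
  {cov : CovariantDerivative I E (TangentSpace I : M → Type _)}

/-- **Derivative of the Gram matrix of fields along a curve** (metric compatibility,
`hasDerivAt_val_apply_along`): if the lifts of the fields `J_k` along `γ` are differentiable at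
`t`, then `(g(J_k, J_l))'(t) = g(D_t J_k, J_l) + g(J_k, D_t J_l)`, i.e. `G' = Ω + Ωᵀ` with
`Ω_{kl} = g(D_t J_k, J_l)`. [cite: ONeillSemiRiemannian1983, Ch. 3, Prop. 18 (3)] -/
theorem hasDerivAt_gram (hcov : g.IsCompatible cov) {κ : Type*} [Fintype κ] {γ : ℝ → M}
    {J : κ → Π t : ℝ, TangentSpace I (γ t)} {t : ℝ}
    (hJd : ∀ k, MDifferentiableAt 𝓘(ℝ, ℝ) I.tangent
      (fun t ↦ (TotalSpace.mk' E (γ t) (J k t) : TangentBundle I M)) t) :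
    HasDerivAt (fun s ↦ Matrix.of fun k l ↦ g.val (γ s) (J k s) (J l s))
      ((Matrix.of fun k l ↦ g.val (γ t) (covariantDerivAlong cov γ (J k) t) (J l t)) +
        (Matrix.of fun k l ↦ g.val (γ t) (covariantDerivAlong cov γ (J k) t) (J l t))ᵀ) t := by
  refine hasDerivAt_pi.2 fun k ↦ hasDerivAt_pi.2 fun l ↦ ?_
  simp only [Matrix.add_apply, Matrix.transpose_apply, Matrix.of_apply]
  have h := g.hasDerivAt_val_apply_along hcov (hJd k) (hJd l)
  rw [g.symm (γ t) (J k t) (covariantDerivAlong cov γ (J l) t)] at h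
  exact h

/-- **The frame-free Jacobi formula**: with `G(s) = (g(J_k(s), J_l(s)))` the Gram matrix of fields
with differentiable lifts along `γ` and `Ω_{kl} = g(D_t J_k, J_l)(t)`, if `det G(t) ≠ 0` then
`(det G)'(t) / (2 det G(t)) = tr (G(t)⁻¹ Ω)` — Jacobi's formula `(det G)' = det G · tr(G⁻¹ G')`
with `G' = Ω + Ωᵀ` and `tr(G⁻¹ Ωᵀ) = tr(G⁻¹ Ω)` for the symmetric `G`. For the screen Jacobi
fields of a null congruence this is the expansion `θ` (Hawking–Ellis 1973, (4.26)/(4.35);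
Chavel 2006, Prop. II.8.2). [cite: Chavel2006, Prop. II.8.2] [cite: HawkingEllis1973CUP, §4.2, (4.26)] -/
theorem deriv_det_gram_div_eq_trace (hcov : g.IsCompatible cov) {κ : Type*} [Fintype κ]
    [DecidableEq κ] {γ : ℝ → M} {J : κ → Π t : ℝ, TangentSpace I (γ t)} {t : ℝ}
    (hJd : ∀ k, MDifferentiableAt 𝓘(ℝ, ℝ) I.tangent
      (fun t ↦ (TotalSpace.mk' E (γ t) (J k t) : TangentBundle I M)) t)
    (hdet : (Matrix.of fun k l ↦ g.val (γ t) (J k t) (J l t)).det ≠ 0) :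
    deriv (fun s ↦ (Matrix.of fun k l ↦ g.val (γ s) (J k s) (J l s)).det) t /
        (2 * (Matrix.of fun k l ↦ g.val (γ t) (J k t) (J l t)).det) =
      ((Matrix.of fun k l ↦ g.val (γ t) (J k t) (J l t))⁻¹ *
        Matrix.of fun k l ↦ g.val (γ t) (covariantDerivAlong cov γ (J k) t) (J l t)).trace := by
  set G : ℝ → Matrix κ κ ℝ := fun s ↦ Matrix.of fun k l ↦ g.val (γ s) (J k s) (J l s) with hG
  set Ω : Matrix κ κ ℝ := Matrix.of fun k l ↦ g.val (γ t) (covariantDerivAlong cov γ (J k) t) (J l t)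
    with hΩ
  have hGsymm : (G t)ᵀ = G t := by
    ext k l
    simp only [hG, Matrix.transpose_apply, Matrix.of_apply]
    exact g.symm (γ t) (J l t) (J k t)
  have hD := hasDerivAt_matrix_det (hasDerivAt_gram g hcov (cov := cov) hJd) hdet
  have hderiv : deriv (fun s ↦ (G s).det) t = (G t).det * ((G t)⁻¹ * (Ω + Ωᵀ)).trace := hD.deriv
  have htr : ((G t)⁻¹ * Ωᵀ).trace = ((G t)⁻¹ * Ω).trace := by
    have h1 : ((G t)⁻¹ * Ωᵀ) = (Ω * (G t)⁻¹)ᵀ := by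
      rw [Matrix.transpose_mul, Matrix.transpose_nonsing_inv, hGsymm]
    rw [h1, Matrix.trace_transpose, Matrix.trace_mul_comm]
  show deriv (fun s ↦ (G s).det) t / (2 * (G t).det) = ((G t)⁻¹ * Ω).trace
  rw [hderiv, Matrix.mul_add, Matrix.trace_add, htr]
  have hdet' : (G t).det ≠ 0 := hdet
  field_simp
  ring

end Gram

/-! ### The slices of the null normal congruence and their null second fundamental form -/

section Slice

variable {E : Type u} [NormedAddCommGroup E] [NormedSpace ℝ E] [FiniteDimensional ℝ E]
  [CompleteSpace E] {M : Type*} [TopologicalSpace M] [ChartedSpace E M] [IsManifold 𝓘(ℝ, E) ∞ M]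
  [T2Space M]
  {E' : Type*} [NormedAddCommGroup E'] [NormedSpace ℝ E']
  {H' : Type*} [TopologicalSpace H'] {I' : ModelWithCorners ℝ E' H'} [I'.Boundaryless]
  {N : Type*} [TopologicalSpace N] [ChartedSpace H' N] [IsManifold I' ∞ N]
  {n : ℕ∞ω} [Fact (1 ≤ n)] (g : LorentzianMetric 𝓘(ℝ, E) n M) [g.HasLeviCivita]
  [CovariantDerivative.ContMDiffCovariantDerivative g.leviCivita 1]
  [CovariantDerivative.ContMDiffCovariantDerivative g.leviCivita (⊤ : ℕ∞)]
  {f : N → M} {L : Π z : N, TangentSpace 𝓘(ℝ, E) (f z)}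

/-- **`D_v K_t = D_t J_v(t)`**: the covariant derivative at `z` in the direction `v` (along the
chart-straight curve, `normalDerivAlong`) of the null normal field `K_t(y) = ∂_t E(y, t)` of the
slice `ψ_t = E(·, t)` of the null normal congruence equals the covariant derivative along the
generator `γ_z` of the Jacobi field `J_v` — the symmetry lemma `D_s ∂_t x = D_t ∂_s x` for the
variation `x(t, s) = E(c_v(s), t)` (second conclusion of `normalExpVariation_jacobi_of_eq`).
O'Neill 1983, Ch. 10, Cor. 40 (`V'` computed through the variation); Hawking–Ellis 1973, §4.2,
"the deviation vector … Lie transported", `∇_K Z = ∇_Z K`. [cite: ONeillSemiRiemannian1983, Ch. 10, Cor. 40] [cite: HawkingEllis1973CUP, §4.2, (4.19)–(4.26)] -/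
theorem normalDerivAlong_slice_eq (hreg : g.leviCivita.IsLocallyContMDiff 1)
    (hL : ContMDiff I' 𝓘(ℝ, E).tangent ∞
      (fun z ↦ (TotalSpace.mk' E (f z) (L z) : TangentBundle 𝓘(ℝ, E) M)))
    (z : N) (v : TangentSpace I' z) {t : ℝ} (ht : t ∈ maximalGeodesicDomain g.leviCivita (f z) (L z)) :
    (g.normalDerivAlong (fun y ↦ expMap g.leviCivita (f y) (t • L y))
        (fun y ↦ velocity 𝓘(ℝ, E) (fun s : ℝ ↦ expMap g.leviCivita (f y) (s • L y)) t) z v : E) =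
      covariantDerivAlong g.leviCivita (fun t : ℝ ↦ expMap g.leviCivita (f z) (t • L z))
        (fun t ↦ velocity 𝓘(ℝ, E) (fun s ↦ expMap g.leviCivita (f (curveThrough I' z v s))
          (t • L (curveThrough I' z v s))) 0) t := by
  set c : ℝ → N := curveThrough I' z v with hc_def
  have hc0 : c 0 = z := curveThrough_zero I' z v
  have hc : ∀ᶠ s in 𝓝 (0 : ℝ), ContMDiffAt 𝓘(ℝ, ℝ) I' ∞ c s :=
    eventually_contMDiffAt_curveThrough z v
  have hγ : (fun t ↦ expMap g.leviCivita (f (c 0)) (t • L (c 0))) =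
      fun t : ℝ ↦ expMap g.leviCivita (f z) (t • L z) := by
    rw [hc0]
  have ht' : t ∈ maximalGeodesicDomain g.leviCivita (f (c 0)) (L (c 0)) := by rw [hc0]; exact ht
  obtain ⟨-, hsymm, -, -⟩ := normalExpVariation_jacobi_of_eq g.toPseudoRiemannianMetric
    (ι := f) (ν := L) hreg hL hc ht' hγ
  rw [hsymm]
  rfl

omit [Fact (1 ≤ n)] in
/-- **`dψ_t(w) = J_w(t)`**: the differential of the slice map `ψ_t = E(·, t)` at `z` applied to `w`
is the Jacobi field `J_w` at time `t` (`nullJacobi_spec`, last conclusion).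
[cite: ONeillSemiRiemannian1983, Ch. 10, Prop. 30 (3)] -/
theorem mfderiv_slice_eq
    (hL : ContMDiff I' 𝓘(ℝ, E).tangent ∞
      (fun z ↦ (TotalSpace.mk' E (f z) (L z) : TangentBundle 𝓘(ℝ, E) M)))
    (z : N) (w : TangentSpace I' z) {t : ℝ} (ht : t ∈ maximalGeodesicDomain g.leviCivita (f z) (L z)) :
    mfderiv I' 𝓘(ℝ, E) (fun y ↦ expMap g.leviCivita (f y) (t • L y)) z w =
      velocity 𝓘(ℝ, E) (fun s ↦ expMap g.leviCivita (f (curveThrough I' z w s))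
        (t • L (curveThrough I' z w s))) 0 := by
  set c : ℝ → N := curveThrough I' z w with hc_def
  have hc0 : c 0 = z := curveThrough_zero I' z w
  have hcv : velocity I' c 0 = w :=
    velocity_curveThrough_zero_holds (I := I') BoundarylessManifold.isInteriorPoint w
  have hc : ∀ᶠ s in 𝓝 (0 : ℝ), ContMDiffAt 𝓘(ℝ, ℝ) I' ∞ c s :=
    eventually_contMDiffAt_curveThrough z w
  have hcd : MDifferentiableAt 𝓘(ℝ, ℝ) I' c 0 := (hc.self_of_nhds).mdifferentiableAt (by simp)
  have ht' : t ∈ maximalGeodesicDomain g.leviCivita (f (c 0)) (L (c 0)) := by rw [hc0]; exact ht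
  have h := velocity_normalExpVariation_eq_mfderiv (cov := g.leviCivita) (ι := f) (ν := L) hL hcd ht'
  rw [hcv, hc0] at h
  exact h.symm

/-- **The null second fundamental form of the slice is the pairing `g(D_t J_v, J_w)`.** For the
slice `ψ_t = E(·, t)` of the null normal congruence and its null normal field
`K_t(y) = ∂_t E(y, t)`: `g(D_v K_t, dψ_t w) = g(D_t J_v(t), J_w(t))` at `z` — with the tree's
convention `χ_K(v, w) = g(D_v K, dψ w)` (`secondFundamentalForm`) the left side is
`χ_{K_t}(v, w)` (`secondFundamentalForm_apply_holds`). Hawking–Ellis 1973, §4.2, `χ_{ab}` /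
CDGH 2001, App. A (null Weingarten map `b(X) = ∇_X K`). [cite: HawkingEllis1973CUP, §4.2, (4.26)] [cite: ChruscielEtAl2001, App. A] -/
theorem val_normalDerivAlong_slice_eq_gram' (hreg : g.leviCivita.IsLocallyContMDiff 1)
    (hL : ContMDiff I' 𝓘(ℝ, E).tangent ∞
      (fun z ↦ (TotalSpace.mk' E (f z) (L z) : TangentBundle 𝓘(ℝ, E) M)))
    (z : N) (v w : TangentSpace I' z) {t : ℝ}
    (ht : t ∈ maximalGeodesicDomain g.leviCivita (f z) (L z)) :
    g.val (expMap g.leviCivita (f z) (t • L z))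
        (g.normalDerivAlong (fun y ↦ expMap g.leviCivita (f y) (t • L y))
          (fun y ↦ velocity 𝓘(ℝ, E) (fun s : ℝ ↦ expMap g.leviCivita (f y) (s • L y)) t) z v)
        (mfderiv I' 𝓘(ℝ, E) (fun y ↦ expMap g.leviCivita (f y) (t • L y)) z w) =
      g.val (expMap g.leviCivita (f z) (t • L z))
        (covariantDerivAlong g.leviCivita (fun t : ℝ ↦ expMap g.leviCivita (f z) (t • L z))
          (fun t ↦ velocity 𝓘(ℝ, E) (fun s ↦ expMap g.leviCivita (f (curveThrough I' z v s))
            (t • L (curveThrough I' z v s))) 0) t)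
        (velocity 𝓘(ℝ, E) (fun s ↦ expMap g.leviCivita (f (curveThrough I' z w s))
          (t • L (curveThrough I' z w s))) 0) := by
  have h1 := normalDerivAlong_slice_eq g hreg hL z v ht
  have h2 := mfderiv_slice_eq g hL z w ht
  rw [h2]
  exact congrArg (fun u : E ↦ g.val (expMap g.leviCivita (f z) (t • L z)) u
    (velocity 𝓘(ℝ, E) (fun s ↦ expMap g.leviCivita (f (curveThrough I' z w s))
      (t • L (curveThrough I' z w s))) 0)) h1

/-- **The null expansion of a slice of the null normal congruence is `D'/(2D)`.** Suppose the slice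
`ψ_t = E(·, t)` is a spacelike immersion (with `C^n` pullbacks, hypotheses `hpb`, `hψ` of the
tree's `nullExpansion`); let `β` be the canonical basis of `T_zN` (`Module.finBasis`), `J_k = J_{β_k}`
the corresponding Jacobi fields along `γ_z` and `D(s) = det (g(J_k(s), J_l(s)))` their Gram
determinant. Then the null expansion of `ψ_t` at `z` with respect to `K_t = ∂_t E(·, t)` —
`θ = tr_{ψ_t^* g} χ_{K_t}` — equals `D'(t)/(2 D(t))`: the metric trace in the basis `β` is
`∑ (G⁻¹)_{lk} χ(β_k, β_l)` (`trace_eq_sum_gram_inv`) with `G` the Gram matrix of `dψ_t β = J(t)`,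
`χ(β_k, β_l) = Ω_{kl}` (`val_normalDerivAlong_slice_eq_gram'`, through
`secondFundamentalForm_apply_basis`), and `tr(G⁻¹Ω) = D'/(2D)` (`deriv_det_gram_div_eq_trace`).
Hawking–Ellis 1973, (4.26): `θ = χ^a{}_a` is the logarithmic rate of change of the area element of
the congruence. [cite: HawkingEllis1973CUP, §4.2, (4.26) and (4.35)] [cite: ChruscielEtAl2001, §2, (2.7)] -/
theorem nullExpansion_slice_eq_logDeriv_gram [FiniteDimensional ℝ E']
    (hreg : g.leviCivita.IsLocallyContMDiff 1)
    (hL : ContMDiff I' 𝓘(ℝ, E).tangent ∞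
      (fun z ↦ (TotalSpace.mk' E (f z) (L z) : TangentBundle 𝓘(ℝ, E) M)))
    (hnull : ∀ z, g.val (f z) (L z) (L z) = 0) (hLn : g.IsNormalTo I' f L)
    {t : ℝ} (hpb : PseudoRiemannianMetric.contMDiff_pullbackBilin 𝓘(ℝ, E) M I' N n)
    (hψ : g.IsSpacelikeImmersion I' (fun y ↦ expMap g.leviCivita (f y) (t • L y)))
    (z : N) (ht : t ∈ maximalGeodesicDomain g.leviCivita (f z) (L z)) :
    haveI : FiniteDimensional ℝ (TangentSpace I' z) := inferInstanceAs (FiniteDimensional ℝ E')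
    g.nullExpansion (fun y ↦ expMap g.leviCivita (f y) (t • L y)) hpb hψ
        (fun y ↦ velocity 𝓘(ℝ, E) (fun s : ℝ ↦ expMap g.leviCivita (f y) (s • L y)) t) z =
      deriv (fun s ↦ (Matrix.of fun k l ↦ g.val (expMap g.leviCivita (f z) (s • L z))
          (velocity 𝓘(ℝ, E) (fun s' ↦ expMap g.leviCivita
            (f (curveThrough I' z (Module.finBasis ℝ (TangentSpace I' z) k) s'))
            (s • L (curveThrough I' z (Module.finBasis ℝ (TangentSpace I' z) k) s'))) 0)
          (velocity 𝓘(ℝ, E) (fun s' ↦ expMap g.leviCivita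
            (f (curveThrough I' z (Module.finBasis ℝ (TangentSpace I' z) l) s'))
            (s • L (curveThrough I' z (Module.finBasis ℝ (TangentSpace I' z) l) s'))) 0)).det) t /
        (2 * (Matrix.of fun k l ↦ g.val (expMap g.leviCivita (f z) (t • L z))
          (velocity 𝓘(ℝ, E) (fun s' ↦ expMap g.leviCivita
            (f (curveThrough I' z (Module.finBasis ℝ (TangentSpace I' z) k) s'))
            (t • L (curveThrough I' z (Module.finBasis ℝ (TangentSpace I' z) k) s'))) 0)
          (velocity 𝓘(ℝ, E) (fun s' ↦ expMap g.leviCivita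
            (f (curveThrough I' z (Module.finBasis ℝ (TangentSpace I' z) l) s'))
            (t • L (curveThrough I' z (Module.finBasis ℝ (TangentSpace I' z) l) s'))) 0)).det) := by
  haveI : FiniteDimensional ℝ (TangentSpace I' z) := inferInstanceAs (FiniteDimensional ℝ E')
  have hLC := PseudoRiemannianMetric.isLeviCivita_leviCivita_holds (g := g.toPseudoRiemannianMetric)
  have hcompat : g.IsCompatible g.leviCivita := hLC.2
  set β := Module.finBasis ℝ (TangentSpace I' z) with hβ
  set γ : ℝ → M := fun s ↦ expMap g.leviCivita (f z) (s • L z) with hγ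
  set J : Fin (Module.finrank ℝ (TangentSpace I' z)) → Π s : ℝ, TangentSpace 𝓘(ℝ, E) (γ s) :=
    fun k s ↦ velocity 𝓘(ℝ, E) (fun s' ↦ expMap g.leviCivita (f (curveThrough I' z (β k) s'))
      (s • L (curveThrough I' z (β k) s'))) 0 with hJdef
  have hspec := fun k ↦ nullJacobi_spec g hreg hL hnull hLn z (β k) ht
  have hJd : ∀ k, MDifferentiableAt 𝓘(ℝ, ℝ) 𝓘(ℝ, E).tangent
      (fun s ↦ (TotalSpace.mk' E (γ s) (J k s) : TangentBundle 𝓘(ℝ, E) M)) t :=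
    fun k ↦ (hspec k).2.1
  have hJE : ∀ k, J k t = mfderiv I' 𝓘(ℝ, E) (fun y ↦ expMap g.leviCivita (f y) (t • L y)) z (β k) :=
    fun k ↦ (hspec k).2.2.2.2.2.2.2
  set ψ : N → M := fun y ↦ expMap g.leviCivita (f y) (t • L y) with hψdef
  set K : Π y : N, TangentSpace 𝓘(ℝ, E) (ψ y) :=
    fun y ↦ velocity 𝓘(ℝ, E) (fun s : ℝ ↦ expMap g.leviCivita (f y) (s • L y)) t with hKdef
  -- the Gram matrix of `dψ_t β` is the Gram matrix `G(t)` of the Jacobi fields, and is invertible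
  have hGψ : (Matrix.of fun k l ↦ (g.inducedMetric ψ hpb hψ).val z (β k) (β l)) =
      Matrix.of fun k l ↦ g.val (γ t) (J k t) (J l t) := by
    ext k l
    simp only [Matrix.of_apply]
    rw [hJE k, hJE l]
    rfl
  have hunit : IsUnit (Matrix.of fun k l ↦ (g.inducedMetric ψ hpb hψ).val z (β k) (β l)).det := by
    have hnd := (g.inducedMetric ψ hpb hψ).nondegenerate_toBilinForm z
    rw [LinearMap.BilinForm.nondegenerate_iff_det_ne_zero β] at hnd
    have h : LinearMap.BilinForm.toMatrix β ((g.inducedMetric ψ hpb hψ).toBilinForm z) =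
        Matrix.of fun k l ↦ (g.inducedMetric ψ hpb hψ).val z (β k) (β l) := by
      ext k l
      rw [LinearMap.BilinForm.toMatrix_apply, PseudoRiemannianMetric.toBilinForm_apply,
        Matrix.of_apply]
    rw [h] at hnd
    exact isUnit_iff_ne_zero.2 hnd
  have hdet : (Matrix.of fun k l ↦ g.val (γ t) (J k t) (J l t)).det ≠ 0 := by
    rw [← hGψ]
    exact hunit.ne_zero
  -- the trace formula in the basis `β`, and `χ(β_k, β_l) = Ω_{kl}`
  have htr := trace_eq_sum_gram_inv (g.inducedMetric ψ hpb hψ) z β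
    (g.secondFundamentalForm I' ψ K z)
  have hχ : ∀ k l, g.secondFundamentalForm I' ψ K z (β k) (β l) =
      g.val (γ t) (covariantDerivAlong g.leviCivita γ (J k) t) (J l t) := by
    intro k l
    rw [hβ, PseudoRiemannianMetric.secondFundamentalForm_apply_basis]
    exact val_normalDerivAlong_slice_eq_gram' g hreg hL z (β k) (β l) ht
  show (g.inducedMetric ψ hpb hψ).trace z (g.secondFundamentalForm I' ψ K z) = _
  rw [htr, deriv_det_gram_div_eq_trace g.toPseudoRiemannianMetric hcompat hJd hdet, hGψ,
    Matrix.trace]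
  simp only [Matrix.diag_apply, Matrix.mul_apply, Matrix.of_apply, hχ]
  rw [Finset.sum_comm]

end Slice

end Literature.Geometry.Lorentzian

end
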